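import Summits.CriticalPhenomena.CardyFormulaZ2.Theorems.CardyComplexConeSLESixFamiliesGiveCardy
import Summits.CriticalPhenomena.CardyFormulaZ2.Theorems.CardyComplexConeParafermionToSLESixFamiliesFlipAllDomainsOfDiag
import HarnessLib

/-!
# `DiagSLESixGivesCardy` (stmt-CriticalPhenomena-18397): vocabulary of the proof (definitions module)

Route `CardyComplexCone`, sub-problem `CriticalPhenomena/CardyFormulaZ2`, support item
`Summit.CriticalPhenomena.CardyFormulaZ2.Theses.CardyComplexCone.DiagSLESixGivesCardy`:
SLE₆ along every admissible family of every ALL-DIAGONAL Dobrushin polygon ⇒ `CardyFormulaZ2`.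
PLAN: PIECE 2 `cardyFormulaZ2_of_diagCardy` (proved) reduces the item to PIECE 1 (diagonal SLE₆ ⇒ Cardy's
crossing limit on a class of diagonal polygonal conformal rectangles rich enough to approximate every Jordan quad);
PIECE 1 is the collar-touch sandwich `cardy_of_statements` of crux 9654 (stubs A–D, F, G landed, shape-blind)
re-run with designer collared domains that are DIAGONAL LATTICE POLYGONS. This file carries, sorry-free, the shared
vocabulary; NOTHING here is asserted (every `def … : Prop` is a statement proved in a sibling helper file of the
item, or a predicate), the one theorem is the unfolding `diagSLESixGivesCardy_iff`.

Objects (composition in `Theorems/CardyComplexConeDiagSLESixGivesCardyGlue.lean`):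

* the class `IsTiltedLatticeRect` of conformal rectangles whose boundary loop is a re-timed TILTED LATTICE
  CYCLE `s ↦ (1+i)·polygonLoop (q at mesh h) (ρ s)` with the four marked points on well separated sides;
* STATEMENT E′ `DiagCollarDomains`: for such a rectangle and `ε > 0`, the two exterior-collared comparison
  rectangles of STUB E of crux 9654 (`UpperCollarGeom` / `LowerCollarGeom`, smooth exterior marks, loops and
  marks `ε`-close) whose chord Dobrushin domains are moreover all-diagonal polygons (`IsDiagRectilinear`);
* STATEMENT T `TiltedLatticeApprox`: every conformal rectangle has, for every `ε > 0`, an `ε`-close tilted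
  lattice rectangle with the same marks;
* `DiagSLESix`: the hypothesis of the item, verbatim (`diagSLESixGivesCardy_iff : item ↔ (DiagSLESix → S)`).

Sources: B. Bollobás, O. Riordan, *Percolation* (CUP 2006), Ch. 7 (collared comparison domains, lattice
approximation); S. Smirnov, C. R. Acad. Sci. Paris 333 (2001) §2; F. Camia, C. M. Newman, PTRF 139 (2007) §§5–7.
(buildfix 2026-08-20: comment-only re-land to re-enqueue the module build after its blocking imports were repaired; no declaration changed.)
-/

noncomputable section

open Set Filter Topology Metric MeasureTheory
open scoped NNReal
open UpperHalfPlane (upperHalfPlaneSet)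
open Literature.Probability Literature.Probability.RandomPlanarGeometry
  Literature.Probability.LatticeModels Literature.Probability.Percolation
open Summit.CriticalPhenomena.CardyFormulaZ2.Cruxes.SLESixFamiliesGiveCardy.CollarTouchSandwich
open Summit.CriticalPhenomena.CardyFormulaZ2.Cruxes.ParafermionToSLESixFamilies.IicTraceFluxPairing
  (IsFamily iface perc SLESixAlong)
open Summit.CriticalPhenomena.CardyFormulaZ2.Cruxes.ParafermionToSLESixFamilies.FlipInvolutionReturnLaw
  (IsDiagRectilinear)
open Summit.CriticalPhenomena.CardyFormulaZ2.Cruxes.LoopsToCrossings.OracleSandwich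
  (stub_discreteCrossing_of_pathIn stub_not_discreteCrossing_of_dualPathIn stub_cardyContinuity
    stub_comparisonGeometry stub_cyclicFlip)
open Summit.CriticalPhenomena.CardyFormulaZ2.Theorems.RectilinearApproximation
  (discreteCrossing_subset_of_lower discreteCrossing_subset_plate bond_le_one_sub_real_openCrossing)

namespace Summit.CriticalPhenomena.CardyFormulaZ2.Theorems.DiagCollar

/-! ### The class of tilted lattice rectangles -/

/-- A **simple lattice cycle** of `ℤ²`: at least four pairwise distinct sites, cyclically consecutive
ones nearest neighbours (the hypotheses of `isSimpleClosedPolygon_meshCycle`). -/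
structure IsLatticeCycle (q : List (Site 2)) : Prop where
  /-- at least four vertices -/
  four_le : 4 ≤ q.length
  /-- pairwise distinct vertices -/
  nodup : ∀ (i j : ℕ) (hi : i < q.length) (hj : j < q.length), q[i] = q[j] → i = j
  /-- cyclically consecutive vertices are lattice neighbours -/
  adj : ∀ (i : ℕ) (hi : i < q.length), (zdGraph 2).Adj q[i] (q[(i + 1) % q.length]'(Nat.mod_lt _ (by omega)))

/-- A **time change**: an increasing homeomorphism of `ℝ` commuting with the unit translation. -/
structure IsTimeChange (ρ : ℝ → ℝ) : Prop where
  /-- continuity -/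
  continuous : Continuous ρ
  /-- strict monotonicity -/
  strictMono : StrictMono ρ
  /-- surjectivity -/
  surjective : Function.Surjective ρ
  /-- commutes with the unit translation -/
  add_one : ∀ s, ρ (s + 1) = ρ s + 1

/-- **Tilted lattice rectangles**: conformal rectangles whose boundary loop is the re-timed tilted lattice
cycle `s ↦ (1 + i) · polygonLoop (q at mesh h) (ρ s)` for a simple lattice cycle `q`, a mesh `h > 0` and a time
change `ρ`, the four marked points being the VERTICES `k₀ < k₁ < k₂ < k₃ (< k₀ + M)` of the cycle (as knot times
`kᵢ / M` of the polygon loop), pairwise at least two sides apart (cyclically). -/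
def IsTiltedLatticeRect (P : ConformalRectangle) : Prop :=
  ∃ (q : List (Site 2)) (h : ℝ) (ρ : ℝ → ℝ) (k : Fin 4 → ℕ), IsLatticeCycle q ∧ 0 < h ∧ IsTimeChange ρ ∧
    (∀ s, P.boundary s = (1 + Complex.I) * polygonLoop (q.map (meshPoint h)) (ρ s)) ∧
    (∀ i, ρ (P.mark i) = (k i : ℝ) / q.length) ∧
    k 0 + 2 ≤ k 1 ∧ k 1 + 2 ≤ k 2 ∧ k 2 + 2 ≤ k 3 ∧ k 3 + 2 ≤ k 0 + q.length

/-! ### The two construction statements -/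

/-- STATEMENT E′ — **all-diagonal exterior-collared comparison rectangles** for tilted lattice rectangles:
STUB E of crux 9654 (`CollarDomains`) restricted to `IsTiltedLatticeRect` and strengthened by the
all-diagonality (`IsDiagRectilinear`) of the two chord Dobrushin domains. -/
def DiagCollarDomains : Prop :=
  ∀ (R : ConformalRectangle), IsTiltedLatticeRect R → ∀ ε : ℝ, 0 < ε →
    (∃ (Q : ConformalRectangle) (c : ℝ), UpperCollarGeom R (Q.chord 0 1 (by decide)) (Q.arc 2) ∧
        IsSmoothMark (Q.chord 0 1 (by decide)) 0 ∧ IsSmoothMark (Q.chord 0 1 (by decide)) 1 ∧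
        (∀ s : ℝ, dist (Q.boundary s) (R.boundary (s + c)) ≤ ε) ∧
        (∀ i : Fin 4, |Q.mark i + c - R.mark i| ≤ ε) ∧ IsDiagRectilinear (Q.chord 0 1 (by decide))) ∧
    (∃ (Q : ConformalRectangle) (c : ℝ), LowerCollarGeom R (Q.chord 0 3 (by decide)) (Q.arc 1) ∧
        IsSmoothMark (Q.chord 0 3 (by decide)) 0 ∧ IsSmoothMark (Q.chord 0 3 (by decide)) 1 ∧
        (∀ s : ℝ, dist (Q.boundary s) (R.boundary (s + c)) ≤ ε) ∧
        |Q.mark 0 + c - R.mark 2| ≤ ε ∧ |Q.mark 1 + c - R.mark 3| ≤ ε ∧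
        |Q.mark 2 + c - (R.mark 0 + 1)| ≤ ε ∧ |Q.mark 3 + c - (R.mark 1 + 1)| ≤ ε ∧
        IsDiagRectilinear (Q.chord 0 3 (by decide)))

/-- STATEMENT T — **tilted lattice approximation**: every conformal rectangle has, for every `ε > 0`, a tilted
lattice rectangle with the same marks whose boundary loop is uniformly `ε`-close. -/
def TiltedLatticeApprox : Prop :=
  ∀ (D : ConformalRectangle) (ε : ℝ), 0 < ε → ∃ P : ConformalRectangle, IsTiltedLatticeRect P ∧
    (∀ i, P.mark i = D.mark i) ∧ ∀ s, dist (P.boundary s) (D.boundary s) ≤ ε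

/-! ### Diagonal SLE₆, verbatim and bundled -/

/-- The hypothesis of the item, verbatim: SLE₆ along every admissible family of every Dobrushin domain whose
frontier is a finite union of slope-`±1` segments. -/
def DiagSLESix : Prop :=
  ∀ (D : Literature.Probability.RandomPlanarGeometry.DobrushinDomain) (Λ : ℝ → Literature.Probability.LatticeModels.DiscreteDobrushin), (∃ S : Finset (ℂ × ℂ), (∀ e ∈ S, (e.1 - e.2).re = (e.1 - e.2).im ∨ (e.1 - e.2).re = -(e.1 - e.2).im) ∧ frontier D.carrier = ⋃ e ∈ S, segment ℝ e.1 e.2) → (∀ δ, (Λ δ).Ω = D.carrier) → (∀ δ, (Λ δ).δ = δ) → Tendsto (fun δ : ℝ => Metric.hausdorffEDist (Λ δ).arcA (D.arc 0)) (𝓝[>] (0:ℝ)) (𝓝 0) → Tendsto (fun δ : ℝ => Metric.hausdorffEDist (Λ δ).arcB (D.arc 1)) (𝓝[>] (0:ℝ)) (𝓝 0) → Tendsto (fun δ : ℝ => Metric.hausdorffEDist (Literature.Probability.LatticeModels.medialPoint δ '' (Λ δ).zdABEdges) {D.pt 0, D.pt 1}) (𝓝[>] (0:ℝ)) (𝓝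 0) → (∀ᶠ δ in 𝓝[>] (0:ℝ), (Λ δ).IsZdAdmissible) → Literature.Probability.RandomPlanarGeometry.ConvergesInLawToSLE 6 D (Ωδ := fun _ => Literature.Probability.Percolation.BondConfig (Literature.Probability.LatticeModels.Site 2)) (fun δ ω => Literature.Probability.RandomPlanarGeometry.CurveClass.mk (if dist (Literature.Probability.LatticeModels.medialExplorationCurve (Λ δ) ω 0) (D.pt 0) ≤ dist (Literature.Probability.LatticeModels.medialExplorationCurve (Λ δ) ω 0) (D.pt 1) then (⟨Literature.Probability.LatticeModels.medialExplorationCurve (Λ δ) ω⟩ : Literature.Probability.RandomPlanarGeometry.Curve ℂ) else ⟨(Literature.Probability.LatticeModels.medialExplorationCurve (Λ δ) ω).comp ⟨unitInterval.symm, unitInterval.continuous_symm⟩⟩)) (fun _ => Literature.Probability.Percolation.bondPercolation (Literature.Probability.LatticeModels.zdGraph 2) Literature.Probability.Percolation.half)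

/-- The item is literally `DiagSLESix → CardyFormulaZ2`. -/
theorem diagSLESixGivesCardy_iff :
    Summit.CriticalPhenomena.CardyFormulaZ2.Theses.CardyComplexCone.DiagSLESixGivesCardy ↔
      (DiagSLESix → _root_.CardyFormulaZ2) := Iff.rfl

end Summit.CriticalPhenomena.CardyFormulaZ2.Theorems.DiagCollar

end
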